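import Literature.Probability.RandomPlanarGeometry.TwoSidedWholePlaneSLEScalingProofs
import HarnessLib

/-!
# Self-similarity of two-sided whole-plane SLE_κ (Zhan (2021), Cor. 4.7): reduction to well-definedness and a continuity theorem

Topic `Probability/RandomPlanarGeometry`; sequel to `TwoSidedWholePlaneSLEScalingProofs`, closing
the circle with the named fact `IsTwoSidedWholePlaneSLENatLawMeas.map_dilatePath`
(`TwoSidedWholePlaneSLEScaling`), the self-similarity half of Zhan (2021), Cor. 4.7 over the
measurably uniformized class of laws. Everything here is proved; no named fact is introduced.

* `IsTwoSidedWholePlaneSLENatLawMeas.ae_firstArm_regular` — in any corrected representation, almost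
  surely the first arm `η₁ = 1/γ₁` is continuous, tends to `0` at `+∞`, to `∞` at `-∞` and never
  vanishes (`firstArm_regular_of_natParamClause` with the whole-plane Loewner curve `γ₁`,
  `WholePlaneLoewnerChain.IsCurve`): its closure `{0} ∪ η₁(ℝ) ∪ {∞}` is a curve in the sphere from
  `∞` to `0`.
* `IsTwoSidedWholePlaneSLENatLawMeas.map_dilatePath_mem_of_continuityTheorem` — **closure of the
  corrected class under the dilations `dilatePath (1/d) a`, `a > 0`**, modulo ONE deterministic
  statement of complex analysis (hypothesis `hCT`): for every continuous `η : ℝ → ℂ` with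
  `η(+∞) = 0`, `η(-∞) = ∞`, `0 ∉ η(ℝ)`, every conformal map `φ : ℍ → Ĉ(η; ∞)` onto the unbounded
  complementary component(s) of the closed curve `{0} ∪ η(ℝ)` (`armComplement η`) with boundary
  value `0` at `0` and `∞` at `∞` has, at every point of the closed half-plane, a limit in the
  Riemann sphere. This is the continuity theorem for conformal maps onto domains with locally
  connected boundary (Pommerenke (1992), Thm 2.1) for that domain — the boundary of a complementary
  component of a curve in the sphere is locally connected — and is NOT in the tree (its bounded
  "cover" form `ConformalEquiv.continuousOn_extendFrom_of_cover` is). With it, the hypothesis `hcl`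
  of `IsTwoSidedWholePlaneSLENatLawMeas.map_dilatePath_of_unique_of_closed` holds.
* `IsTwoSidedWholePlaneSLENatLawMeas.map_dilatePath_of_unique_of_continuityTheorem` — **the named
  fact from well-definedness (`hu`) and the continuity theorem (`hCT`)**: Zhan's one-line proof
  ("the self-similarity of `γ̂₀` follows easily from the scaling invariance of `ν^#_{∞⇌0}` and the
  scaling covariance of the Minkowski content measure") with its two implicit inputs made explicit —
  `hu` is "`ν^#_{∞⇌0}` is ONE law" (uniqueness in law of whole-plane SLE_κ(2) as defined by
  `IsWholePlaneSLEKappaRho`, independence of the second arm's conditional law from the measurable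
  uniformizer selector, and the transfer to the Minkowski content parametrisation across probability
  spaces — not in the tree), `hCT` is what makes "chordal SLE_κ in the remaining domain" scale
  covariantly as a parametrised curve in `ℂ`.

## References

* D. Zhan, *SLE loop measures*, PTRF 179 (2021), arXiv:1702.08026 (arXiv numbering): §2.1–2.2,
  Cor. 4.7 and its proof (p. 23). [Zhan2021SLELoopMeasures]
* Ch. Pommerenke, *Boundary Behaviour of Conformal Maps* (1992), Thm 2.1. [PommerenkeBBCM1992]
-/

noncomputable section

open Set Filter Topology MeasureTheory ProbabilityTheory Complex
open UpperHalfPlane (upperHalfPlaneSet)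
open scoped NNReal Real ENNReal

namespace Literature.Probability.RandomPlanarGeometry

open scoped PathBorel

/-- **Almost-sure regularity of the first arm of a corrected natural law.** In a corrected
representation `(η₁, η₂, γ̂)` of a two-sided whole-plane SLE_κ natural law, almost surely the first
arm `η₁` is continuous, `η₁(t) → 0` as `t → +∞`, `η₁(t) → ∞` as `t → -∞`, and `η₁(t) ≠ 0` for all `t`
(`firstArm_regular_of_natParamClause`: `η₁ = 1/γ₁` with `γ₁` almost surely a whole-plane Loewner
curve from `0`, continuous with `γ₁(-∞) = 0`, `WholePlaneLoewnerChain.IsCurve`; and `γ̂` traces `η₁`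
on `(-∞, 0)`). Zhan (2021), §2.2 (the first arm is a whole-plane SLE_κ(2) curve from `∞` to `0`).
[cite: Zhan2021SLELoopMeasures, §2.2] -/
theorem IsTwoSidedWholePlaneSLEPairMeas.ae_firstArm_regular {κ : ℝ≥0} {Ω : Type*}
    [MeasurableSpace Ω] {P : Measure Ω} {η₁ : Ω → ℝ → ℂ} {η₂ : Ω → ℝ≥0 → ℂ} {γ : Ω → C(ℝ, ℂ)}
    (hpair : IsTwoSidedWholePlaneSLEPairMeas κ P η₁ η₂)
    (hae : ∀ᵐ ω ∂P, IsNaturallyParametrized (1 + (κ : ℝ) / 8) (γ ω) ∧ γ ω 0 = 0 ∧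
        (∃ e : ℝ≥0 ≃o ℝ≥0, ∀ t : ℝ≥0, γ ω t = η₂ ω (e t)) ∧
        (∃ e' : Iio (0 : ℝ) ≃o ℝ, ∀ t : Iio (0 : ℝ), γ ω t = η₁ ω (e' t))) :
    ∀ᵐ ω ∂P, Continuous (η₁ ω) ∧ Tendsto (η₁ ω) atTop (𝓝 0) ∧
      Tendsto (η₁ ω) atBot (cocompact ℂ) ∧ ∀ t, η₁ ω t ≠ 0 := by
  obtain ⟨⟨γ₁, hγ₁, hη₁⟩, -⟩ := hpair
  obtain ⟨-, X, q₀, -, -, -, -, -, hcurve⟩ := hγ₁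
  filter_upwards [hae, hcurve] with ω ⟨hnat, h0, _, he'⟩ ⟨C, hC⟩
  exact firstArm_regular_of_natParamClause hnat h0 he' (hη₁ ω) hC.1 hC.2.1

/-- **Closure of the corrected class under dilations, modulo the continuity theorem** (the hypothesis
`hcl` of `IsTwoSidedWholePlaneSLENatLawMeas.map_dilatePath_of_unique_of_closed`). Granted (`hCT`)
that for every continuous `η : ℝ → ℂ` with `η(+∞) = 0`, `η(-∞) = ∞` and `0 ∉ η(ℝ)`, every conformal
map `φ : ℍ → Ĉ(η; ∞)` (`armComplement η`) with boundary value `0` at `0` and `∞` at `∞` has at every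
point of the closed half-plane a limit in the sphere — Pommerenke (1992), Thm 2.1 for the
complement of a curve from `∞` to `0` — the dilate `(dilatePath (1/d) a)_* μ`, `a > 0`, of a corrected
two-sided whole-plane SLE_κ natural law `μ` is a corrected natural law: in a representation of `μ` the
first arm is almost surely such a curve (`ae_firstArm_regular`), so `hCT` supplies the boundary
regularity hypothesis of `isTwoSidedWholePlaneSLENatLawMeas_map_dilatePath_of_boundaryLimits`.
[cite: Zhan2021SLELoopMeasures, Cor. 4.7 (proof)] -/
theorem IsTwoSidedWholePlaneSLENatLawMeas.map_dilatePath_mem_of_continuityTheorem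
    (hCT : ∀ η : ℝ → ℂ, Continuous η → Tendsto η atTop (𝓝 0) → Tendsto η atBot (cocompact ℂ) →
      (∀ t, η t ≠ 0) → ∀ φ : ConformalEquiv upperHalfPlaneSet (armComplement η),
        φ.HasBoundaryValue 0 0 → Tendsto φ (cocompact ℂ ⊓ 𝓟 upperHalfPlaneSet) (cocompact ℂ) →
          ∀ x ∈ closure upperHalfPlaneSet, (∃ y, Tendsto φ (𝓝[upperHalfPlaneSet] x) (𝓝 y)) ∨
            Tendsto φ (𝓝[upperHalfPlaneSet] x) (cocompact ℂ))
    {κ : ℝ≥0} {μ : Measure C(ℝ, ℂ)} (h : IsTwoSidedWholePlaneSLENatLawMeas κ μ) {a : ℝ}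
    (ha : 0 < a) :
    IsTwoSidedWholePlaneSLENatLawMeas κ (μ.map (dilatePath (1 / (1 + (κ : ℝ) / 8)) a)) := by
  obtain ⟨Ω, _, P, η₁, η₂, γ, hpair, hγ, rfl, hae⟩ := h
  refine isTwoSidedWholePlaneSLENatLawMeas_map_dilatePath_of_boundaryLimits hpair hγ hae ?_ ha
  filter_upwards [hpair.ae_firstArm_regular hae] with ω ⟨hc, htop, hbot, hne⟩
  exact hCT (η₁ ω) hc htop hbot hne

/-- **Zhan's Corollary 4.7 (self-similarity, corrected class) from well-definedness and the
continuity theorem.** Granted (`hu`) the well-definedness of the corrected two-sided whole-plane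
SLE_κ natural law (two corrected natural laws for the same `κ` coincide — "`ν^#_{∞⇌0}` is one law")
and (`hCT`) the continuity theorem for conformal maps of `ℍ` onto the complement `Ĉ(η; ∞)` of a
curve from `∞` to `0` (a limit in the sphere at every point of the closed half-plane; Pommerenke
(1992), Thm 2.1), the named fact `IsTwoSidedWholePlaneSLENatLawMeas.map_dilatePath` holds: the
dilate of a corrected natural law is a corrected natural law
(`map_dilatePath_mem_of_continuityTheorem`), hence equal to it. This is Zhan's sentence "the
self-similarity of `γ̂₀` follows easily from the scaling invariance of `ν^#_{∞⇌0}` and the scaling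
covariance of the Minkowski content measure" with its two implicit inputs made explicit.
[cite: Zhan2021SLELoopMeasures, Cor. 4.7] -/
theorem IsTwoSidedWholePlaneSLENatLawMeas.map_dilatePath_of_unique_of_continuityTheorem
    (hu : ∀ (κ : ℝ≥0) (μ μ' : Measure C(ℝ, ℂ)),
      IsTwoSidedWholePlaneSLENatLawMeas κ μ → IsTwoSidedWholePlaneSLENatLawMeas κ μ' → μ = μ')
    (hCT : ∀ η : ℝ → ℂ, Continuous η → Tendsto η atTop (𝓝 0) → Tendsto η atBot (cocompact ℂ) →
      (∀ t, η t ≠ 0) → ∀ φ : ConformalEquiv upperHalfPlaneSet (armComplement η),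
        φ.HasBoundaryValue 0 0 → Tendsto φ (cocompact ℂ ⊓ 𝓟 upperHalfPlaneSet) (cocompact ℂ) →
          ∀ x ∈ closure upperHalfPlaneSet, (∃ y, Tendsto φ (𝓝[upperHalfPlaneSet] x) (𝓝 y)) ∨
            Tendsto φ (𝓝[upperHalfPlaneSet] x) (cocompact ℂ)) :
    IsTwoSidedWholePlaneSLENatLawMeas.map_dilatePath :=
  fun κ _ _ _ h _ ha ↦ hu κ _ _
    (IsTwoSidedWholePlaneSLENatLawMeas.map_dilatePath_mem_of_continuityTheorem hCT h ha) h

/-- The same, phrased through the reduction of `TwoSidedWholePlaneSLEScaling`: the continuity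
theorem `hCT` DISCHARGES the closure hypothesis `hcl` of
`IsTwoSidedWholePlaneSLENatLawMeas.map_dilatePath_of_unique_of_closed'` (for all `a > 1`, indeed
all `a > 0`). [cite: Zhan2021SLELoopMeasures, Cor. 4.7 (proof)] -/
theorem IsTwoSidedWholePlaneSLENatLawMeas.closed_of_continuityTheorem
    (hCT : ∀ η : ℝ → ℂ, Continuous η → Tendsto η atTop (𝓝 0) → Tendsto η atBot (cocompact ℂ) →
      (∀ t, η t ≠ 0) → ∀ φ : ConformalEquiv upperHalfPlaneSet (armComplement η),
        φ.HasBoundaryValue 0 0 → Tendsto φ (cocompact ℂ ⊓ 𝓟 upperHalfPlaneSet) (cocompact ℂ) →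
          ∀ x ∈ closure upperHalfPlaneSet, (∃ y, Tendsto φ (𝓝[upperHalfPlaneSet] x) (𝓝 y)) ∨
            Tendsto φ (𝓝[upperHalfPlaneSet] x) (cocompact ℂ)) :
    ∀ (κ : ℝ≥0) (μ : Measure C(ℝ, ℂ)), 0 < κ → κ < 8 → IsTwoSidedWholePlaneSLENatLawMeas κ μ →
      ∀ a : ℝ, 1 < a →
        IsTwoSidedWholePlaneSLENatLawMeas κ (μ.map (dilatePath (1 / (1 + (κ : ℝ) / 8)) a)) :=
  fun _ _ _ _ h _ ha ↦
    IsTwoSidedWholePlaneSLENatLawMeas.map_dilatePath_mem_of_continuityTheorem hCT h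
      (zero_lt_one.trans ha)

end Literature.Probability.RandomPlanarGeometry
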